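import Summits.ValiantsHypothesis.ValiantsHypothesis.Theorems.VPBoundarySquareNbBinomialTable
import Mathlib.Data.Nat.Choose.Multinomial
import HarnessLib

/-!
# VPBoundarySquare — W18 converse series, FILE 3: BINARY GADGETS for FILE 4
Folklore identities (Möbius inversion on `{0,1}^n`; character orthogonality = `sum_boolCube_char`;
multinomial = Π binomials of partial sums) and three small gadgets (`eqGadget`, `zeroTest`, `mobW`);
infrastructure for FILE 4 only; nothing here decides `binomTable ∈ VNP^ℂ`, `B_nb`, `VPnb` vs `VNPnb`
or `VP` vs `VNP`; the converse «`binomTable ∈ VNP^ℂ ⟹ B_nb`» (FILE 4, UNBUILT) is Malod's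
generic-computation/Pascaline mechanism (Malod 2007; Bürgisser 2024 §4.2 (4.5)–(4.6), p0016
L63–L116, and the remark before Thm 4.10, p0017 L54–L60; Poizat 2014 «Malod and the Pascaline» UNREAD,
acq-15003 — if it prints the characteristic-0 statement the series is a PORT OF PRINT and will be
graded known/port). §6 `choose_binVal_eq_sum_witness` is how a hypothetical `IsVNPFamily binomTable`
is CONSUMED: `binomTable L = boolSum h ⟹ C(binVal r, binVal κ) = Σ_s Σ_e (Π mobW) · h(𝟙_s, 𝟙_e)`.
Refs: [Burgisser2024Completeness, §4.2, Rem. 4.9]; [BhargavDwivediSaxena2024, Lemma 4.1 (p. 13)].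
-/

set_option linter.dupNamespace false

noncomputable section

open MvPolynomial Finset
open Literature.Computability.AlgebraicComplexity
open Summit.ValiantsHypothesis.ValiantsHypothesis.Theorems.VPBoundarySquareNbBitSplit
open Summit.ValiantsHypothesis.ValiantsHypothesis.Theorems.VPBoundarySquareNbGRHSlot
open Summit.ValiantsHypothesis.ValiantsHypothesis.Theorems.VPBoundarySquareNbBinomialTable

namespace Summit.ValiantsHypothesis.ValiantsHypothesis.Theorems.VPBoundarySquareNbBinaryGadgets

/-! ## §1 Multinomial of a row = product of binomials of its partial sums -/

/-- `multinom(α_0,…,α_{Q-1}) = Π_{q<Q} C(α_0 + ⋯ + α_q, α_q)`. [folklore] -/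
theorem multinomial_range_eq_prod_choose (Q : ℕ) (α : ℕ → ℕ) :
    Nat.multinomial (range Q) α = ∏ q ∈ range Q, (∑ i ∈ range (q + 1), α i).choose (α q) := by
  induction Q with
  | zero => simp
  | succ Q ih =>
    rw [prod_range_succ, ← ih, sum_range_succ, Finset.range_add_one,
      Nat.multinomial_insert notMem_range_self, add_comm (α Q), mul_comm]

variable {F : Type*} [Field F]

/-! ## §2 A workspace-only factor leaves the Boolean sum as a constant -/

/-- A factor in the Boolean (workspace) variables only leaves the Boolean sum as the constant
`C (Ψ(𝟙_e))`. [folklore] -/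
theorem aeval_boolPoint_rename_inr {τ W : Type*} (e : W → Bool) (Ψ : MvPolynomial W F) :
    aeval (Sum.elim X fun j => if e j then (1 : MvPolynomial τ F) else 0) (rename Sum.inr Ψ) =
      C (eval (fun j => if e j then 1 else 0) Ψ) := by
  have hpt : (Sum.elim X fun j => if e j then (1 : MvPolynomial τ F) else 0) ∘ Sum.inr =
      fun j => (C (if e j then (1 : F) else 0) : MvPolynomial τ F) := by
    funext j
    simp only [Function.comp_apply, Sum.elim_inr, apply_ite C, map_one, map_zero]
  rw [aeval_rename, hpt]
  induction Ψ using MvPolynomial.induction_on with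
  | C a => simp
  | add p q hp hq => simp only [map_add, hp, hq]
  | mul_X p i hp => simp only [map_mul, hp, aeval_X, eval_X]

/-! ## §3 The EQUALITY-TEST gadget (a character sum over `K` fresh bits) -/

/-- `eqGadget ω K B s u v = Π_ℓ [Π_{j,i} (1 + s_ℓ u_{ji} (ω^{2^{ℓ+i}} - 1))] · [Π_i (1 + s_ℓ v_i
(ω^{-2^{ℓ+i}} - 1))]`: compares `U = Σ_j binVal(u_j)` (a SUM of `B`-bit numbers) with the `K`-bit
number `V = binVal(v)` through the character `s ↦ (ω^{U-V})^{binVal s}`.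
[cite: BhargavDwivediSaxena2024, Lemma 4.1 (p. 13)] -/
def eqGadget {ι J : Type*} [Fintype J] (ω : F) (K B : ℕ) (s : Fin K → ι) (u : J → Fin B → ι)
    (v : Fin K → ι) : MvPolynomial ι F :=
  ∏ ℓ : Fin K, ((∏ j : J, ∏ i : Fin B,
      (1 + X (s ℓ) * X (u j i) * C (ω ^ 2 ^ ((ℓ : ℕ) + i) - 1))) *
    ∏ i : Fin K, (1 + X (s ℓ) * X (v i) * C ((ω ^ 2 ^ ((ℓ : ℕ) + i))⁻¹ - 1)))

/-- **The gadget at a Boolean point is the character value `(ω^U (ω^V)⁻¹)^{binVal s}`.**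
[cite: BhargavDwivediSaxena2024, Lemma 4.1 (p. 13)] -/
theorem eval_boolPoint_eqGadget {ι J : Type*} [Fintype J] (ω : F) (K B : ℕ) (s : Fin K → ι)
    (u : J → Fin B → ι) (v : Fin K → ι) (e : ι → Bool) :
    eval (fun x => if e x then (1 : F) else 0) (eqGadget ω K B s u v) =
      (ω ^ (∑ j, binVal fun i => e (u j i)) * (ω ^ binVal fun i => e (v i))⁻¹) ^
        binVal fun ℓ => e (s ℓ) := by
  have hfac : ∀ (a b : ι) (c : F),
      eval (fun x => if e x then (1 : F) else 0) (1 + X a * X b * C (c - 1)) =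
        if (e a && e b) then c else 1 := fun a b c => by
    simp only [map_add, map_one, map_mul, eval_X, eval_C]
    cases e a <;> cases e b <;> simp
  rw [show binVal (fun ℓ => e (s ℓ)) = ∑ ℓ : Fin K, (if e (s ℓ) then 2 ^ (ℓ : ℕ) else 0) from rfl,
    ← prod_pow_eq_pow_sum, eqGadget, map_prod]
  refine prod_congr rfl fun ℓ _ => ?_
  simp only [map_mul, map_prod, hfac]
  by_cases hs : e (s ℓ) = true
  · rw [if_pos hs]
    simp only [hs, Bool.true_and]
    have hU : ∀ j : J, ∏ i : Fin B, (if e (u j i) then ω ^ 2 ^ ((ℓ : ℕ) + i) else 1) =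
        (ω ^ 2 ^ (ℓ : ℕ)) ^ binVal fun i => e (u j i) := fun j => by
      rw [← prod_ite_pow_two_pow_eq]
      exact prod_congr rfl fun i _ => by rw [pow_add, pow_mul]
    have hV : ∏ i : Fin K, (if e (v i) then (ω ^ 2 ^ ((ℓ : ℕ) + i))⁻¹ else 1) =
        ((ω ^ 2 ^ (ℓ : ℕ))⁻¹) ^ binVal fun i => e (v i) := by
      rw [← prod_ite_pow_two_pow_eq]
      exact prod_congr rfl fun i _ => by rw [pow_add, pow_mul, inv_pow]
    rw [prod_congr rfl fun j _ => hU j, prod_pow_eq_pow_sum, hV]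
    ring
  · simp [hs]

/-- **Summed over its `K` fresh bits the gadget TESTS EQUALITY: `Σ_b = 2^K · [U = V]`** (for
`U < 2^K`; character orthogonality, FILE 1a `sum_boolCube_char`).
[cite: BhargavDwivediSaxena2024, Lemma 4.1 (p. 13)] -/
theorem sum_eval_boolPoint_eqGadget {ι J : Type*} [Fintype J] {ω : F} {K : ℕ}
    (hω : IsPrimitiveRoot ω (2 ^ K)) (B : ℕ) (u : J → Fin B → ι) (v : Fin K → ι) (e : ι → Bool)
    (hU : ∑ j, binVal (fun i => e (u j i)) < 2 ^ K) :
    ∑ b : Fin K → Bool, eval (fun x => if Sum.elim e b x then (1 : F) else 0)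
        (eqGadget ω K B Sum.inr (fun j i => Sum.inl (u j i)) fun i => Sum.inl (v i)) =
      if ∑ j, binVal (fun i => e (u j i)) = binVal fun i => e (v i) then ((2 ^ K : ℕ) : F)
      else 0 := by
  simp only [eval_boolPoint_eqGadget, Sum.elim_inl, Sum.elim_inr]
  exact sum_boolCube_char hω hU (binVal_lt_two_pow _)

/-- Bridge (uniform-bound form of `complexity_finset_prod_le`): `L(Π_i f_i) ≤ (c + 1) · #κ` when
every `L(f_i) ≤ c`. [cite: Burgisser2000, §2.1] -/
theorem complexity_prod_le_of_le {ι κ : Type*} [Fintype κ] (f : κ → MvPolynomial ι F) (c : ℕ)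
    (h : ∀ i, complexity (f i) ≤ c) : complexity (∏ i, f i) ≤ (c + 1) * Fintype.card κ := by
  refine (complexity_finset_prod_le _ _).trans ?_
  calc ∑ i, complexity (f i) + (univ : Finset κ).card
      ≤ ∑ _i : κ, c + (univ : Finset κ).card := Nat.add_le_add_right (sum_le_sum fun i _ => h i) _
    _ = (c + 1) * Fintype.card κ := by simp only [sum_const, card_univ, smul_eq_mul]; ring

/-- **`L(eqGadget) ≤ K · (4(|J|·B + K) + |J| + 2)`** (polynomial size).
[cite: Burgisser2000, §2.1] -/
theorem complexity_eqGadget_le {ι J : Type*} [Fintype J] (ω : F) (K B : ℕ) (s : Fin K → ι)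
    (u : J → Fin B → ι) (v : Fin K → ι) :
    complexity (eqGadget ω K B s u v) ≤
      K * (4 * (Fintype.card J * B + K) + Fintype.card J + 2) := by
  have htri : ∀ (a b : ι) (c : F), complexity (1 + X a * X b * C (c - 1) : MvPolynomial ι F) ≤ 3 :=
    fun a b c => by
    have h1 : complexity (X a * X b : MvPolynomial ι F) ≤ 0 + 0 + 1 :=
      (complexity_mul_le_holds _ _).trans (by rw [complexity_X_holds, complexity_X_holds])
    have h2 : complexity (X a * X b * C (c - 1) : MvPolynomial ι F) ≤ 0 + 0 + 1 + 0 + 1 :=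
      (complexity_mul_le_holds _ _).trans (by rw [complexity_C_holds]; omega)
    have h0 : complexity (1 : MvPolynomial ι F) = 0 := by rw [← C_1, complexity_C_holds]
    exact (complexity_add_le_holds _ _).trans (by rw [h0]; omega)
  have hA : ∀ ℓ : Fin K, complexity (∏ j : J, ∏ i : Fin B,
      (1 + X (s ℓ) * X (u j i) * C (ω ^ 2 ^ ((ℓ : ℕ) + i) - 1) : MvPolynomial ι F)) ≤
        ((3 + 1) * B + 1) * Fintype.card J := fun ℓ => by
    refine complexity_prod_le_of_le _ _ fun j => ?_
    calc complexity (∏ i : Fin B, (1 + X (s ℓ) * X (u j i) * C (ω ^ 2 ^ ((ℓ : ℕ) + i) - 1) :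
          MvPolynomial ι F))
        ≤ (3 + 1) * Fintype.card (Fin B) := by
          refine complexity_prod_le_of_le _ _ fun i => ?_
          exact htri _ _ _
      _ = (3 + 1) * B := by rw [Fintype.card_fin]
  have hV : ∀ ℓ : Fin K, complexity (∏ i : Fin K,
      (1 + X (s ℓ) * X (v i) * C ((ω ^ 2 ^ ((ℓ : ℕ) + i))⁻¹ - 1) : MvPolynomial ι F)) ≤
        (3 + 1) * K := fun ℓ => by
    calc complexity (∏ i : Fin K, (1 + X (s ℓ) * X (v i) * C ((ω ^ 2 ^ ((ℓ : ℕ) + i))⁻¹ - 1) :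
          MvPolynomial ι F))
        ≤ (3 + 1) * Fintype.card (Fin K) := by
          refine complexity_prod_le_of_le _ _ fun i => ?_
          exact htri _ _ _
      _ = (3 + 1) * K := by rw [Fintype.card_fin]
  calc complexity (eqGadget ω K B s u v)
      ≤ (((3 + 1) * B + 1) * Fintype.card J + (3 + 1) * K + 1 + 1) * Fintype.card (Fin K) := by
        unfold eqGadget
        refine complexity_prod_le_of_le _ _ fun ℓ => ?_
        exact (complexity_mul_le_holds _ _).trans
          (Nat.add_le_add_right (Nat.add_le_add (hA ℓ) (hV ℓ)) 1)
    _ = K * (4 * (Fintype.card J * B + K) + Fintype.card J + 2) := by rw [Fintype.card_fin]; ring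

/-! ## §4 The ZERO-TEST gadget -/

/-- `zeroTest u = Π_j (1 - u_j)`: `1` iff all the bits `u_j` vanish. [folklore] -/
def zeroTest {ι J : Type*} [Fintype J] (u : J → ι) : MvPolynomial ι F := ∏ j : J, (1 - X (u j))

/-- At a Boolean point the zero test is the indicator of «all bits `0`». [folklore] -/
theorem eval_boolPoint_zeroTest {ι J : Type*} [Fintype J] (u : J → ι) (e : ι → Bool) :
    eval (fun x => if e x then (1 : F) else 0) (zeroTest u) =
      if ∀ j, e (u j) = false then 1 else 0 := by
  unfold zeroTest
  rw [map_prod]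
  simp only [map_sub, map_one, eval_X]
  split_ifs with h
  · exact prod_eq_one fun j _ => by simp [h j]
  · obtain ⟨j, hj⟩ := not_forall.mp h
    exact prod_eq_zero (mem_univ j) (by cases hb : e (u j) <;> simp_all)

/-- A sum of binary numbers vanishes iff every bit does. [folklore] -/
theorem sum_binVal_eq_zero_iff {J : Type*} [Fintype J] {B : ℕ} (b : J → Fin B → Bool) :
    ∑ j, binVal (b j) = 0 ↔ ∀ j i, b j i = false := by
  rw [sum_eq_zero_iff]
  simp only [mem_univ, true_implies]
  refine forall_congr' fun j => ?_
  unfold binVal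
  rw [sum_eq_zero_iff]
  simp only [mem_univ, true_implies]
  refine forall_congr' fun i => ?_
  cases hb : b j i <;> simp

/-- `L(zeroTest u) ≤ 3 · #J`. [cite: Burgisser2000, §2.1] -/
theorem complexity_zeroTest_le {ι J : Type*} [Fintype J] (u : J → ι) :
    complexity (zeroTest (F := F) u) ≤ 3 * Fintype.card J := by
  unfold zeroTest
  have h : ∀ j : J, complexity (1 - X (u j) : MvPolynomial ι F) ≤ 2 := fun j => by
    have e1 : (1 - X (u j) : MvPolynomial ι F) = 1 + C (-1) * X (u j) := by
      rw [map_neg, C_1, neg_one_mul, sub_eq_add_neg]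
    have hm : complexity (C (-1) * X (u j) : MvPolynomial ι F) ≤ 0 + 0 + 1 :=
      (complexity_mul_le_holds _ _).trans (by rw [complexity_C_holds, complexity_X_holds])
    have h0 : complexity (1 : MvPolynomial ι F) = 0 := by rw [← C_1, complexity_C_holds]
    rw [e1]
    exact (complexity_add_le_holds _ _).trans (by rw [h0]; omega)
  calc complexity (∏ j : J, (1 - X (u j) : MvPolynomial ι F))
      ≤ (2 + 1) * Fintype.card J := complexity_prod_le_of_le _ _ h
    _ = 3 * Fintype.card J := by norm_num

/-! ## §5 MÖBIUS EXTRACTION of a multilinear coefficient from Boolean-point values -/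

/-- The Möbius weight on `{0,1}`: `mobW b s = [s ≤ b] · (-1)^{b-s}`. [folklore] -/
def mobW : Bool → Bool → F
  | false, false => 1
  | false, true => 0
  | true, false => -1
  | true, true => 1

/-- `mobW b s = 1 - s - 2b + 3bs` (the bilinear polynomial FILE 4 writes for it). [folklore] -/
theorem mobW_eq (b s : Bool) :
    (mobW b s : F) = 1 - (if s then 1 else 0) - 2 * (if b then 1 else 0) +
      3 * (if b then 1 else 0) * (if s then 1 else 0) := by
  cases b <;> cases s <;> norm_num [mobW]

/-- One variable: `Σ_{s ∈ {0,1}} mobW b s · s^d = [d = b]` for `d ≤ 1`. [folklore] -/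
theorem sum_mobW_mul_pow (b : Bool) {d : ℕ} (hd : d ≤ 1) :
    ∑ s : Bool, mobW b s * (if s then (1 : F) else 0) ^ d =
      if d = (if b then 1 else 0) then 1 else 0 := by
  rw [Fintype.sum_bool]
  obtain rfl | rfl := Nat.le_one_iff_eq_zero_or_eq_one.mp hd <;> cases b <;> norm_num [mobW]

/-- **Möbius extraction on the Boolean cube**: for a MULTILINEAR `H`, the coefficient of the
square-free monomial `x^{indMon b}` is the signed sum `Σ_s (Π_i mobW (b i) (s i)) · H(𝟙_s)` of its
values at Boolean points. [folklore] -/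
theorem coeff_indMon_eq_sum_mobW {ι : Type*} [Fintype ι] [DecidableEq ι] (H : MvPolynomial ι F)
    (hH : ∀ i, H.degreeOf i ≤ 1) (b : ι → Bool) :
    coeff (indMon b) H =
      ∑ s : ι → Bool, (∏ i, mobW (b i) (s i)) * eval (fun x => if s x then (1 : F) else 0) H := by
  have key : ∀ d ∈ H.support, ∑ s : ι → Bool, (∏ i, mobW (b i) (s i)) *
      (coeff d H * ∏ i, (if s i then (1 : F) else 0) ^ d i) =
        if d = indMon b then coeff d H else 0 := by
    intro d hd
    have hd1 : ∀ i, d i ≤ 1 := fun i => (monomial_le_degreeOf i hd).trans (hH i)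
    have h2 : ∀ i, ∑ t : Bool, mobW (b i) t * (if t then (1 : F) else 0) ^ d i =
        if d i = (if b i then 1 else 0) then 1 else 0 := fun i => sum_mobW_mul_pow (b i) (hd1 i)
    calc ∑ s : ι → Bool, (∏ i, mobW (b i) (s i)) *
          (coeff d H * ∏ i, (if s i then (1 : F) else 0) ^ d i)
        = coeff d H *
            ∑ s : ι → Bool, ∏ i, (mobW (b i) (s i) * (if s i then (1 : F) else 0) ^ d i) := by
          rw [mul_sum]
          refine sum_congr rfl fun s _ => ?_
          rw [prod_mul_distrib]
          ring
      _ = coeff d H * ∏ i, ∑ t : Bool, mobW (b i) t * (if t then (1 : F) else 0) ^ d i := by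
          congr 1
          exact (Fintype.prod_sum fun i t => mobW (b i) t * (if t then (1 : F) else 0) ^ d i).symm
      _ = coeff d H * if d = indMon b then 1 else 0 := by
          rw [prod_congr rfl fun i _ => h2 i, Fintype.prod_boole]
          congr 1
          refine if_congr ⟨fun h => ?_, fun h i => ?_⟩ rfl rfl
          · ext i
            rw [h i, indMon_apply]
          · rw [h, indMon_apply]
      _ = if d = indMon b then coeff d H else 0 := by rw [mul_ite, mul_one, mul_zero]
  simp_rw [eval_eq', mul_sum]
  rw [sum_comm, sum_congr rfl key, Finset.sum_ite_eq']
  split_ifs with h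
  · rfl
  · exact notMem_support_iff.mp h

/-- Bit-splits are multilinear: `deg_{y} (bitSplit L p) ≤ 1` for every variable `y`.
[cite: Burgisser2024Completeness, Thm. 4.8 (p0017)] -/
theorem degreeOf_bitSplit_le_one {σ : Type*} [Fintype σ] (L : ℕ)
    (p : MvPolynomial σ F) (x : σ × Fin L) : (bitSplit L p).degreeOf x ≤ 1 := by
  classical
  rw [degreeOf_le_iff]
  intro m hm
  rw [bitSplit_eq_sum_monomial] at hm
  obtain ⟨m', -, hm'⟩ := Finset.mem_biUnion.mp (support_sum hm)
  rw [Finset.mem_singleton.mp (support_monomial_subset hm'), indMon_apply]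
  split_ifs <;> simp

/-! ## §6 The BINOMIAL gadget: `C(r, κ)` from a Boolean-sum witness of `binomTable` -/

/-- **Binomial coefficients of binary arguments from ANY Boolean-sum presentation of the table**:
if `binomTable L = boolSum h` then `C(binVal r, binVal κ) = Σ_s Σ_e (Π_x mobW ((r,κ)_x) (s x)) ·
h(𝟙_s, 𝟙_e)` (FILE 1 `coeff_binomTable` + §5 + §2). This is how a hypothetical
`IsVNPFamily binomTable` is CONSUMED by FILE 4.
[cite: Burgisser2024Completeness, Rem. 4.9 (p0017 L54–L60)] -/
theorem choose_binVal_eq_sum_witness {L u : ℕ} (h : MvPolynomial ((Fin 2 × Fin L) ⊕ Fin u) ℂ)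
    (hh : binomTable L = boolSum h) (r κ : Fin L → Bool) :
    (((binVal r).choose (binVal κ) : ℕ) : ℂ) =
      ∑ s : Fin 2 × Fin L → Bool, ∑ e : Fin u → Bool,
        (∏ x, mobW (![r, κ] x.1 x.2) (s x)) *
          eval (Sum.elim (fun x => if s x then (1 : ℂ) else 0) fun j => if e j then 1 else 0)
            h := by
  have hc : (((binVal r).choose (binVal κ) : ℕ) : ℂ) =
      coeff (indMon fun x => ![r, κ] x.1 x.2) (binomTable L) := by
    simpa using (coeff_binomTable L fun x => ![r, κ] x.1 x.2).symm
  rw [hc, coeff_indMon_eq_sum_mobW (binomTable L)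
    (fun x => degreeOf_bitSplit_le_one L (binomGen ℂ L) x)]
  refine sum_congr rfl fun s _ => ?_
  rw [hh, eval_boolSum, mul_sum]
  rfl

end Summit.ValiantsHypothesis.ValiantsHypothesis.Theorems.VPBoundarySquareNbBinaryGadgets

end
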